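import Summits.CriticalPhenomena.PercolationContinuityZ3.Theorems.Transplant.SkelFrmBChoiceDepth
import Summits.CriticalPhenomena.PercolationContinuityZ3.Theorems.Transplant.SkelFrmBChoiceLinks
import Summits.CriticalPhenomena.PercolationContinuityZ3.Theorems.Transplant.SkelFrmBParamsSlotsT
import HarnessLib

/-!
# N2 (frames-only node `SamePDropOfSkeletonFrm₁`, OPEN) — (ζ″) ledger: THE (C)-COLUMN RESIDUAL SLOT FUNCTIONS `NegB.gxC / fxC / exC` AND THEIR FLOOR LEMMAS
# (lead g12 2026-08-23T08:31:58Z: the residual-slot file is stmt's; each column posts its residual FUNCTION + floor list, the node tuple takes the union)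

The floors the (C) column (and J19's four R′0 rows of the (F) value layer, lead 08:47:30Z) puts on the residual slots, as SLOT FUNCTIONS of the p-fixed data (so that
the node file's residuals are `gxQ := gxC ⊔ gxF ⊔ gxR` etc. with `le_max` discharges, and nobody re-edits a residual when a floor is added):
* box residual **`gxC mk : Neg.FSlot := max {gFloorKG … mk, 40·K·KS0.R'0 … mk, 22000·Kq·(KS0.R'0 … mk + 2)}`** (CorrKG's `hg`, ReadNums' `hg2`, J19 `hR0`/`hℓA`);
* width residual **`fxC mk : Neg.FSlot := 2000·Kq·(KS0.R'0 … mk + 2)`** (J19 `hnA`/`hRn0`, EqNumL-free through `fT`/`n₁L_le_nL`);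
* excess residual **`exC mk : GSlot := max {KS0.r₀0 t D mk (RLD …) + 3, ZD … + 4}`** (HX's `hρ1/hρ3` and `hρ2`), where **`RLD κ Φ t p D g f := D.R (scale t (M_L g) (n_L g f))`**
  is p3-g16's kit-prism radius `RL` (SkelFrmBChoiceLinks) read at `(D, g, f)` (`RL_eq_RLD`, `rfl`).
* floor lemmas `gxC_floors`, `exC_floors`, `fxC_floor`; transfer to any dominating slot value: **`Hg_of_ge`** (`gxC ≤ gv ⇒` HX's `Hg`), **`Hex_of_ge`** (HX's `Hex`);
  J19 service: **`hR0_of_ge`** (`22000·(R'0+2) ≤ M_L (KS.gT mk gx)`), **`hℓA_of_ge`** (`22000·Kq·(R'0+2) ≤ ℓ_L`, needs `EqNumL`), **`hnA_of_ge`** (`2000·Kq·(R'0+2) ≤ n_L … (KS.fT mk fx)`,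
  EqNumL-free), **`hRn0_of_ge`** (`R'0 ≤ n_L`).
CELL-AGNOSTIC (no `fcellsS/T`); imports Depth (ZD, ReadNums/Window/CorrKG chain), Links (RL), SlotsT (gT/fT).
NON-VACUITY: definitions + `le_max`-level lemmas.
builds on p205010 (kernel theorem, internal audit signed; external expert review pending) — nothing in this file uses p205010; NOTHING is claimed about the open
node `SamePDropOfSkeletonFrm₁`.
Lane `prim-bschramm`, seat `prim-bschramm-stmt` (gen 21); helper file (`--supports stmt-CriticalPhenomena-4575 --as helper`).
[cite: KozmaNitzan2024, §4 Theorem 6 (pp. 25–31): the order of constants] [cite: MartineauTassion2017, §3.2 Lemma 3.5]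
-/

open scoped Classical

noncomputable section

namespace Summit.CriticalPhenomena.PercolationContinuityZ3.Theorems.Transplant

namespace PlanarSkeletonFrm

namespace NegB

open Literature.Probability.Percolation Literature.Probability.LatticeModels SimpleGraph
open SkelConc (Consts)
open Skelφ.StepI (DataNS OutNS)
open Neg

/-! ## §1 The kit-prism radius read at `(D, g, f)` -/

section RLD

variable (κ : Consts) {V : Type} [DecidableEq V] [Countable V] {G : SimpleGraph V} [G.LocallyFinite] (Φ : PlanarSkeletonFrm G) (t : V) (p : unitInterval)

/-- **p3-g16's long link region's prism radius `RL`, read at `(D, g, f)`** (so that it is a floor on the excess slot `ex : GSlot`). [this work] -/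
def RLD (D : DataNS V) (g f : ℕ) : ℕ := D.R (D.toDataN.scale t (ML κ Φ t p D g) (nL κ Φ t p D g f))

/-- `RL κ Φ t p O gv fv = RLD κ Φ t p O.merged (gOf …) (fOf …)` (by `rfl`). [folklore] -/
theorem RL_eq_RLD (O : OutNS V) (gv fv : Neg.FSlot) : RL κ Φ t p O gv fv = RLD κ Φ t p O.merged (gOf κ Φ t p O gv) (fOf κ Φ t p O fv) := rfl

end RLD

/-! ## §2 The (C)-column residual slot functions -/

/-- **The (C)-column BOX residual** `gxC mk := max {gFloorKG, 40·K·R′0, 22000·Kq·(R′0+2)}`. [this work] -/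
def gxC (mk : ℕ) : Neg.FSlot := fun κ _ _ _ _ _ Φ t p D =>
  max (gFloorKG κ Φ t p D mk) (max (40 * Neg.K κ * KS0.R'0 κ Φ t p D mk) (22000 * Neg.Kq κ * (KS0.R'0 κ Φ t p D mk + 2)))

/-- **The (C)-column WIDTH residual** `fxC mk := 2000·Kq·(R′0+2)`. [this work] -/
def fxC (mk : ℕ) : Neg.FSlot := fun κ _ _ _ _ _ Φ t p D => 2000 * Neg.Kq κ * (KS0.R'0 κ Φ t p D mk + 2)

/-- **The (C)-column EXCESS residual** `exC mk := max {KS0.r₀0 t D mk (RLD …) + 3, ZD + 4}`. [this work] -/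
def exC (mk : ℕ) : GSlot := fun κ _ _ _ _ _ Φ t p D g f => max (KS0.r₀0 t D mk (RLD κ Φ t p D g f) + 3) (ZD κ Φ t p D g f + 4)

section Floors

variable (κ : Consts) {V : Type} [DecidableEq V] [Countable V] {G : SimpleGraph V} [G.LocallyFinite] (Φ : PlanarSkeletonFrm G) (t : V) (p : unitInterval)
  (D : DataNS V) (g f mk : ℕ)

/-- `gxC` by name. [folklore] -/
theorem gxC_at : gxC mk κ Φ t p D = max (gFloorKG κ Φ t p D mk) (max (40 * Neg.K κ * KS0.R'0 κ Φ t p D mk) (22000 * Neg.Kq κ * (KS0.R'0 κ Φ t p D mk + 2))) := rfl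

/-- `fxC` by name. [folklore] -/
theorem fxC_at : fxC mk κ Φ t p D = 2000 * Neg.Kq κ * (KS0.R'0 κ Φ t p D mk + 2) := rfl

/-- `exC` by name. [folklore] -/
theorem exC_at : exC mk κ Φ t p D g f = max (KS0.r₀0 t D mk (RLD κ Φ t p D g f) + 3) (ZD κ Φ t p D g f + 4) := rfl

/-- **The three box floors inside `gxC`.** [folklore] -/
theorem gxC_floors : gFloorKG κ Φ t p D mk ≤ gxC mk κ Φ t p D ∧ 40 * Neg.K κ * KS0.R'0 κ Φ t p D mk ≤ gxC mk κ Φ t p D ∧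
    22000 * Neg.Kq κ * (KS0.R'0 κ Φ t p D mk + 2) ≤ gxC mk κ Φ t p D := by
  refine ⟨?_, ?_, ?_⟩ <;> rw [gxC_at] <;> omega

/-- **The two excess floors inside `exC`.** [folklore] -/
theorem exC_floors : KS0.r₀0 t D mk (RLD κ Φ t p D g f) + 3 ≤ exC mk κ Φ t p D g f ∧ ZD κ Φ t p D g f + 4 ≤ exC mk κ Φ t p D g f := by
  refine ⟨?_, ?_⟩ <;> rw [exC_at] <;> omega

/-- The width floor inside `fxC` (equality). [folklore] -/
theorem fxC_floor : 2000 * Neg.Kq κ * (KS0.R'0 κ Φ t p D mk + 2) ≤ fxC mk κ Φ t p D := le_of_eq (fxC_at κ Φ t p D mk).symm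

end Floors

/-! ## §3 Transfer to any dominating slot value (the node file's `gxQ/fxQ/exQ ⊒ gxC/fxC/exC`) -/

section Transfer

variable {κ : Consts} {V : Type} [DecidableEq V] [Countable V] {G : SimpleGraph V} [G.LocallyFinite] {Φ : PlanarSkeletonFrm G} {t : V} {p : unitInterval} {mk : ℕ}

/-- **HX's `Hg`** from any box slot value dominating `gxC`. [folklore] -/
theorem Hg_of_ge {gv : Neg.FSlot} (h : ∀ D : DataNS V, gxC mk κ Φ t p D ≤ gv κ Φ t p D) (D : DataNS V) :
    gFloorKG κ Φ t p D mk ≤ gv κ Φ t p D ∧ 40 * Neg.K κ * KS0.R'0 κ Φ t p D mk ≤ gv κ Φ t p D :=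
  ⟨(gxC_floors κ Φ t p D mk).1.trans (h D), (gxC_floors κ Φ t p D mk).2.1.trans (h D)⟩

/-- **HX's `Hex`** from any excess slot value dominating `exC`. [folklore] -/
theorem Hex_of_ge {ex : GSlot} (h : ∀ (D : DataNS V) (g f : ℕ), exC mk κ Φ t p D g f ≤ ex κ Φ t p D g f) (D : DataNS V) (g f : ℕ) :
    KS0.r₀0 t D mk (RLD κ Φ t p D g f) + 3 ≤ ex κ Φ t p D g f ∧ ZD κ Φ t p D g f + 4 ≤ ex κ Φ t p D g f :=
  ⟨(exC_floors κ Φ t p D g f mk).1.trans (h D g f), (exC_floors κ Φ t p D g f mk).2.trans (h D g f)⟩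

/-- **J19 `hR0`**: `22000·(R′0+2) ≤ M_L (KS.gT mk gx)` from any box residual dominating `gxC` (`gx ≤ gT ≤ M_L`). [folklore] -/
theorem hR0_of_ge {gx : Neg.FSlot} (h : ∀ D : DataNS V, gxC mk κ Φ t p D ≤ gx κ Φ t p D) (D : DataNS V) :
    22000 * (KS0.R'0 κ Φ t p D mk + 2) ≤ ML κ Φ t p D (KS.gT mk gx κ Φ t p D) ∧
      22000 * Neg.Kq κ * (KS0.R'0 κ Φ t p D mk + 2) ≤ ML κ Φ t p D (KS.gT mk gx κ Φ t p D) := by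
  have h1 := (gxC_floors κ Φ t p D mk).2.2.trans ((h D).trans ((KS.gT_floors κ Φ t p D mk gx).2.2.2.trans (ML_le_ML κ Φ t p D _).2))
  have hKq := Neg.one_le_Kq κ
  refine ⟨le_trans ?_ h1, h1⟩
  calc 22000 * (KS0.R'0 κ Φ t p D mk + 2) = 22000 * 1 * (KS0.R'0 κ Φ t p D mk + 2) := by ring
    _ ≤ 22000 * Neg.Kq κ * (KS0.R'0 κ Φ t p D mk + 2) := by gcongr

/-- **J19 `hℓA`**: `22000·Kq·(R′0+2) ≤ ℓ_L` at the box slot `KS.gT mk gx`, under the numeric long clause (`M_L + 1 ≤ ℓ_L`). [folklore] -/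
theorem hℓA_of_ge {gx : Neg.FSlot} (h : ∀ D : DataNS V, gxC mk κ Φ t p D ≤ gx κ Φ t p D) (D : DataNS V) {f : ℕ}
    (hN : EqNumL κ Φ t p D (KS.gT mk gx κ Φ t p D) f) : 22000 * Neg.Kq κ * (KS0.R'0 κ Φ t p D mk + 2) ≤ ℓL κ Φ t p D (KS.gT mk gx κ Φ t p D) f := by
  have h1 := (hR0_of_ge h D).2
  have h2 := hN.ℓ_le
  have h1' : ((22000 * Neg.Kq κ * (KS0.R'0 κ Φ t p D mk + 2) : ℕ) : ℤ) ≤ (ML κ Φ t p D (KS.gT mk gx κ Φ t p D) : ℤ) := by exact_mod_cast h1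
  have : ((22000 * Neg.Kq κ * (KS0.R'0 κ Φ t p D mk + 2) : ℕ) : ℤ) ≤ (ℓL κ Φ t p D (KS.gT mk gx κ Φ t p D) f : ℕ) := by linarith
  exact_mod_cast this

/-- **J19 `hnA`**: `2000·Kq·(R′0+2) ≤ n_L g (KS.fT mk fx)` from any width residual dominating `fxC` (EqNumL-free, any box value `g`). [folklore] -/
theorem hnA_of_ge {fx : Neg.FSlot} (h : ∀ D : DataNS V, fxC mk κ Φ t p D ≤ fx κ Φ t p D) (D : DataNS V) (g : ℕ) :
    2000 * Neg.Kq κ * (KS0.R'0 κ Φ t p D mk + 2) ≤ nL κ Φ t p D g (KS.fT mk fx κ Φ t p D) :=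
  (fxC_floor κ Φ t p D mk).trans ((h D).trans (((KS.fT_floors κ Φ t p D mk fx).2.2.2).trans (n₁L_le_nL κ Φ t p D g _).2))

/-- **J19 `hRn0`**: `R′0 ≤ n_L g (KS.fT mk fx)` (from `hnA`). [folklore] -/
theorem hRn0_of_ge {fx : Neg.FSlot} (h : ∀ D : DataNS V, fxC mk κ Φ t p D ≤ fx κ Φ t p D) (D : DataNS V) (g : ℕ) :
    KS0.R'0 κ Φ t p D mk ≤ nL κ Φ t p D g (KS.fT mk fx κ Φ t p D) := by
  have h1 := hnA_of_ge h D g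
  have hKq := Neg.one_le_Kq κ
  have : KS0.R'0 κ Φ t p D mk ≤ 2000 * Neg.Kq κ * (KS0.R'0 κ Φ t p D mk + 2) := by nlinarith
  exact this.trans h1

end Transfer

end NegB

end PlanarSkeletonFrm

end Summit.CriticalPhenomena.PercolationContinuityZ3.Theorems.Transplant

end
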